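import Literature.AlgebraicGeometry.Morphisms.ClosedImmersionOfInfinitesimalFactorisationsConnected
import HarnessLib

/-!
# A closed immersion through which all infinitesimal neighbourhoods of its own points factor is an OPEN IMMERSION

Layer `Literature/AlgebraicGeometry/Morphisms`, namespace `Literature.AlgebraicGeometry.Morphisms`.  THEOREMS ONLY (no definition, no named
fact, no instance, no notation, no `sorry`).  Cell `hodgecm-mathlib` (D-0151 / D-0183 FLOOR 0), programme P1, sub-line F-3 «dual abelian
scheme», stub (K) `stub_F3K` by the TORSION road (census `B-provers/B-p03/g20/F3K/CENSUS-F3K-TorsionRoad.B-p03g20.md`, B-p03 (g20)),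
brick **(T5) the open-immersion criterion** — the sequel of ★ D3″ `IsClosedImmersion.isIso_of_forall_infinitesimal_factors`
([MumfordAV1970] §6, proof of the theorem of the cube: «the closed subscheme contains every point together with all its infinitesimal
neighbourhoods, hence it is open») and ★ D3‴ `IsClosedImmersion.isOpen_range_of_forall_infinitesimal_factors` (B-p07 (g16)): there the
conclusion is «`i` is an isomorphism» when EVERY point of `W` has its infinitesimal neighbourhoods in `Z`, resp. «the image is open» when
only the points of the image do; here the latter hypothesis gives the natural common refinement «`i` is an OPEN IMMERSION» (hence `Z` is an
open and closed subscheme).  Count-neutral capital: HC_CM is proved only modulo the 7 printed citations until rung 0 closes — nothing here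
bears on a summit statement.

Proof.  The image `V` is open (★ D3‴); `i` factors as `j ≫ V.ι` through the open subscheme `V` (Mathlib `IsOpenImmersion.lift`), `j` is a closed
immersion (`V.ι` is separated, Mathlib `IsClosedImmersion.of_comp`) whose image is all of `V`; the infinitesimal neighbourhoods of the points
of `V` are those of `W` (the stalk maps of the open immersion `V.ι` are isomorphisms, Mathlib `Scheme.SpecMap_stalkMap_fromSpecStalk`), so they
factor through `j` (§1); hence `j` is an isomorphism by ★ D3″ and `i = j ≫ V.ι` is an open immersion.

* §1 `exists_infinitesimal_factors_of_fac_ι` — transport of an infinitesimal factorisation `Spec(𝒪_{W,t}/𝔪^{n+1}) → Z → W` at a point of an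
  open `V ⊆ W` to the factorisation `Z → V` ([StacksProject] Tag 01QN bookkeeping; [GortzWedhorn2023] Lemma 24.72).
* §2 **`IsClosedImmersion.isOpenImmersion_of_forall_infinitesimal_factors`** — the criterion, hypothesis shape VERBATIM that of ★ D3‴.

## References
* [MumfordAV1970] D. Mumford, *Abelian Varieties* (1970), §6, theorem of the cube (proof: the subscheme is open and closed).
* [GortzWedhorn2023] U. Görtz, T. Wedhorn, *Algebraic Geometry II* (2023), Lemma 24.72 (p. 409).
* [StacksProject] The Stacks Project, Tag 01QN (closed immersions and ideal sheaves), Tag 00IP (Krull's intersection theorem).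
-/

noncomputable section

universe u

open CategoryTheory AlgebraicGeometry IsLocalRing TopologicalSpace Opposite

namespace Literature.AlgebraicGeometry.Morphisms

variable {W : Scheme.{u}}

/-! ## §1 Infinitesimal neighbourhoods of the points of an open subscheme -/

/-- **Transport of infinitesimal factorisations to an open subscheme.**  Let `V ⊆ W` be open, `j : Z → V` with `j ≫ V.ι = i`, `t` a point of
`V` and `n : ℕ`.  If the `n`-th infinitesimal neighbourhood `Spec(𝒪_{W,t}/𝔪_t^{n+1}) → W` of `t` IN `W` factors through `i`, then the `n`-th
infinitesimal neighbourhood `Spec(𝒪_{V,t}/𝔪_t^{n+1}) → V` of `t` IN `V` factors through `j`: the stalk map `𝒪_{W,t} → 𝒪_{V,t}` of `V.ι` is a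
local isomorphism compatible with `fromSpecStalk` (Mathlib `Scheme.SpecMap_stalkMap_fromSpecStalk`), so it induces a map of the truncations
and the factorisation is checked after composing with the monomorphism `V.ι`. [cite: GortzWedhorn2023, Lemma 24.72 (p. 409)]
[cite: StacksProject, Tag 01QN] -/
theorem exists_infinitesimal_factors_of_fac_ι {Z : Scheme.{u}} (i : Z ⟶ W) (V : W.Opens) (j : Z ⟶ (V : Scheme.{u}))
    (hj : j ≫ V.ι = i) (t : (V : Scheme.{u})) (n : ℕ)
    (hv : ∃ v : Spec (.of (W.presheaf.stalk (V.ι.base t) ⧸ maximalIdeal (W.presheaf.stalk (V.ι.base t)) ^ (n + 1))) ⟶ Z,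
      v ≫ i = Spec.map (CommRingCat.ofHom (Ideal.Quotient.mk (maximalIdeal (W.presheaf.stalk (V.ι.base t)) ^ (n + 1)))) ≫
        W.fromSpecStalk (V.ι.base t)) :
    ∃ v : Spec (.of ((V : Scheme.{u}).presheaf.stalk t ⧸ maximalIdeal ((V : Scheme.{u}).presheaf.stalk t) ^ (n + 1))) ⟶ Z,
      v ≫ j = Spec.map (CommRingCat.ofHom (Ideal.Quotient.mk (maximalIdeal ((V : Scheme.{u}).presheaf.stalk t) ^ (n + 1)))) ≫
        (V : Scheme.{u}).fromSpecStalk t := by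
  obtain ⟨v, hvi⟩ := hv
  -- the stalk map `𝒪_{W,t} → 𝒪_{V,t}` of `V.ι` (a local isomorphism) induces a map of the truncations
  have hle : maximalIdeal (W.presheaf.stalk (V.ι.base t)) ^ (n + 1) ≤
      (maximalIdeal ((V : Scheme.{u}).presheaf.stalk t) ^ (n + 1)).comap (V.ι.stalkMap t).hom := by
    rw [← IsLocalRing.maximalIdeal_comap (V.ι.stalkMap t).hom]
    exact Ideal.le_comap_pow _ (n + 1)
  have hsq : CommRingCat.ofHom (Ideal.Quotient.mk (maximalIdeal (W.presheaf.stalk (V.ι.base t)) ^ (n + 1))) ≫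
      CommRingCat.ofHom (Ideal.quotientMap (maximalIdeal ((V : Scheme.{u}).presheaf.stalk t) ^ (n + 1)) (V.ι.stalkMap t).hom hle) =
      V.ι.stalkMap t ≫ CommRingCat.ofHom (Ideal.Quotient.mk (maximalIdeal ((V : Scheme.{u}).presheaf.stalk t) ^ (n + 1))) :=
    CommRingCat.hom_ext (by
      simp only [CommRingCat.hom_comp, CommRingCat.hom_ofHom]
      exact Ideal.quotientMap_comp_mk hle)
  refine ⟨Spec.map (CommRingCat.ofHom (Ideal.quotientMap (maximalIdeal ((V : Scheme.{u}).presheaf.stalk t) ^ (n + 1))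
    (V.ι.stalkMap t).hom hle)) ≫ v,
    ?_⟩
  rw [← cancel_mono V.ι]
  simp only [Category.assoc]
  rw [hj, hvi, ← Spec.map_comp_assoc, hsq, Spec.map_comp_assoc, Scheme.SpecMap_stalkMap_fromSpecStalk]
  rfl

/-! ## §2 The open-immersion criterion -/

/-- **A closed immersion through which all infinitesimal neighbourhoods of ITS OWN points factor is an OPEN IMMERSION** (`W` locally
noetherian; hypothesis shape VERBATIM that of ★ `IsClosedImmersion.isOpen_range_of_forall_infinitesimal_factors`): the image `V` is open
(★ D3‴), `i = j ≫ V.ι` with `j : Z → V` a closed immersion (Mathlib `IsOpenImmersion.lift`, `IsClosedImmersion.of_comp`) onto `V`, the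
infinitesimal neighbourhoods of the points of `V` factor through `j` (§1), so `j` is an isomorphism (★ D3″
`IsClosedImmersion.isIso_of_forall_infinitesimal_factors`) and `i` is an open immersion.  [MumfordAV1970] §6 proves the theorem of the cube
through exactly this «open and closed» mechanism; [GortzWedhorn2023] Lemma 24.72 is the textbook form.
[cite: MumfordAV1970, §6 (theorem of the cube, proof: the subscheme is open)] [cite: GortzWedhorn2023, Lemma 24.72 (p. 409)] -/
theorem IsClosedImmersion.isOpenImmersion_of_forall_infinitesimal_factors [IsLocallyNoetherian W] {Z : Scheme.{u}} (i : Z ⟶ W)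
    [IsClosedImmersion i]
    (h : ∀ t ∈ Set.range i.base, ∀ n : ℕ,
      ∃ v : Spec (.of (W.presheaf.stalk t ⧸ maximalIdeal (W.presheaf.stalk t) ^ (n + 1))) ⟶ Z,
        v ≫ i = Spec.map (CommRingCat.ofHom (Ideal.Quotient.mk (maximalIdeal (W.presheaf.stalk t) ^ (n + 1)))) ≫
          W.fromSpecStalk t) :
    IsOpenImmersion i := by
  -- the open image `V` and the factorisation `i = j ≫ V.ι`
  let V : W.Opens := ⟨Set.range i.base, IsClosedImmersion.isOpen_range_of_forall_infinitesimal_factors i h⟩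
  have hV : Set.range i.base ⊆ Set.range V.ι.base := by
    rw [Scheme.Opens.range_ι]
    exact subset_rfl
  let j : Z ⟶ (V : Scheme.{u}) := IsOpenImmersion.lift V.ι i hV
  have hj : j ≫ V.ι = i := IsOpenImmersion.lift_fac V.ι i hV
  haveI : IsClosedImmersion (j ≫ V.ι) := by rw [hj]; infer_instance
  haveI : IsClosedImmersion j := IsClosedImmersion.of_comp j V.ι
  -- every point of `V` is in the image of `i`, so its infinitesimal neighbourhoods (in `W`, hence in `V`) factor through `j`
  have hmem : ∀ t : (V : Scheme.{u}), V.ι.base t ∈ Set.range i.base := fun t => by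
    have ht : V.ι.base t ∈ Set.range V.ι.base := Set.mem_range_self t
    rwa [Scheme.Opens.range_ι] at ht
  haveI : IsIso j := IsClosedImmersion.isIso_of_forall_infinitesimal_factors j fun t n =>
    exists_infinitesimal_factors_of_fac_ι i V j hj t n (h (V.ι.base t) (hmem t) n)
  rw [← hj]
  infer_instance

end Literature.AlgebraicGeometry.Morphisms

end
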